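import Literature.Combinatorics.Sahi2008.SetPartitionForm
import Literature.Combinatorics.Sahi2008.Symmetry
import HarnessLib

/-!
# Richards' conjugate cumulants `κ′_n`, the cumulants `κ_n`, and Sahi's comparison with `E_n`
# (`κ′_n = E_n` for `n ≤ 5`, `κ′_6 ≠ E_6`, `κ′_6(1,…,1) = 20 > 0`)

Topic `Literature/Combinatorics/Sahi2008` (companion of `SetPartitionForm.lean`: there Sahi's definition (7) of
`E_n` as a signed sum over set partitions is identified with the tree's recursive `sahiE`).

## Sources, verbatim (read 2026-08-20 from the materialised texts)

D. St. P. Richards, *Algebraic methods toward higher-order probability inequalities, II*, Ann. Probab. **32**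
(2004) 1509–1544 [Richards2004] (Project Euclid copy, corpus `paper:url-a35428b45c2b`):

* p. 1512, (1.5): "`κ₃(f₁,f₂,f₃) := E(f₁f₂f₃) − [E(f₁f₂)E(f₃) + E(f₁f₃)E(f₂) + E(f₁)E(f₂f₃)] + 2E(f₁)E(f₂)E(f₃)`
  is a cumulant of the random variables `f₁, f₂` and `f₃`"; (1.6): "We define the third-order *conjugate cumulant*
  `κ′₃(f₁,f₂,f₃) := 2E(f₁f₂f₃) − [E(f₁f₂)E(f₃) + E(f₁f₃)E(f₂) + E(f₁)E(f₂f₃)] + E(f₁)E(f₂)E(f₃)`, which is derived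
  from `κ₃` by 'reversing' the order of the absolute value of the coefficients appearing in (1.5)."
  "THEOREM 1.1. Let `L` be a finite distributive lattice, let `μ` be an MTP₂ probability measure on `L`, and let
  `f₁, f₂` and `f₃` be nonnegative increasing functions on `L`. Then `κ′₃(f₁,f₂,f₃) ≥ 0`. (1.7)"
  "COROLLARY 1.2. Under the same hypotheses as Theorem 1.1, `κ₃(f₁,f₂,f₃) ≥ −[E(f₁f₂f₃) − E(f₁)E(f₂)E(f₃)]`."
  "(1.7) can be rewritten as `Cov(f₁f₂,f₃) − E(f₁)Cov(f₂,f₃) + Cov(f₁f₃,f₂) ≥ 0`."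
* p. 1513, Theorem 1.3 with (1.8) `κ′₄ := 6E(f₁f₂f₃f₄) − 2[E(f₁f₂f₃)E(f₄) + ⋯] − [E(f₁f₂)E(f₃f₄) + ⋯]
  + [E(f₁f₂)E(f₃)E(f₄) + ⋯] − E(f₁)E(f₂)E(f₃)E(f₄)` and (1.9) `κ′₅` (= the tree's `sahiE_five` display).
* p. 1520–1521: for a partition `λ` of weight `m`, `P_λ(f₁,…,f_m) := Π_{j=1}^{l(λ)} E(Π_{k=1}^{λ_j} f_{λ₁+⋯+λ_{j−1}+k})`,
  `D(λ)` = the permutations giving distinct `P_λ(τ·f)`; (2.20) "the `m`th-order cumulant …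
  `κ_m(f₁,…,f_m) := Σ_{|λ|=m} (−1)^{l(λ)−1} (l(λ) − 1)! Σ_{τ∈D(λ)} P_λ(τ·(f₁,…,f_m))`, and we define the
  `m`th-order conjugate cumulant (2.21) `κ′_m(f₁,…,f_m) := Σ_{|λ|=m} (−1)^{l(λ)−1} (l(λ′) − 1)! Σ_{τ∈D(λ)}
  P_λ(τ·(f₁,…,f_m))`" (`λ′` the conjugate partition; p. 1520: "`λ′₁ = l(λ)`", so `l(λ′) = λ₁`, the largest part);
  Conjecture 2.5 (ii) "(2.18) `P_m(f₁,…,f_{m−1},1) ≡ d_m P_{m−1}(f₁,…,f_{m−1})`", (iii) "(2.19) `P_m(1,…,1) = 0`";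
  p. 1521: "For `m = 2,3,4,5` … the coefficients `c_λ = (−1)^{l(λ)−1}(l(λ′) − 1)!` … satisfy (2.19). Also, it can
  be verified that, for `m = 3,4,5`, the `κ′_m` satisfy (2.18) with `d_m = m − 2`. … For `m ≥ 6`, it appears that
  the conjugate cumulants do not satisfy (2.19). In fact, it appears to us that `κ′_m(1,…,1) > 0` for all `m ≥ 6`."

S. Sahi, *Higher correlation inequalities*, Combinatorica **28** (2008) 209–227 [Sahi2008] (author's reprint,
corpus `paper:url-5f6060b183b5`), p. 213–214: "The positivity of `E_n(f₁,…,f_n)` for `n = 3,4,5` was first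
observed by Richards in [8], who in the general case considered slightly different expressions of the form
`κ′_n(f₁,…,f_n) = Σ_{λ⊢n} c′_λ E_λ` where (9) `c′_λ = (−1)^{l(λ)−1} (l(λ′) − 1)!` and `λ′` is the conjugate
partition of `λ`. … the usual cumulants, which are given by the formula `κ_n(f₁,…,f_n) = Σ_{λ⊢n}
(−1)^{l(λ)−1} (l(λ) − 1)! E_λ`. … Now one has the identity `l(λ′) = λ₁` and moreover if `λ` is a partition of
`n ≤ 5`, then the second and subsequent parts of `λ` are either 2 or 1, and so `(λ_i − 1)! = 1` for all `i ≥ 2`.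
Comparing formulas (6) and (9) we observe that we have `c_λ = c′_λ` for all `λ ⊢ n ≤ 5`. Thus, by an amazing
coincidence, one get `κ′_n = E_n` for `n ≤ 5`. However for `n = 6` we have `κ′_6 ≠ E_6` since the two
functions differ in the coefficient of `E_(3,3)`. Indeed Richards observed that the inequality `κ′_6 ≥ 0` is not
sharp, since one has `κ′_6(1,1,1,1,1,1) > 0` …".  (Sahi's (6): `c_λ = (−1)^{l(λ)−1} Π_i (λ_i − 1)!`; his
Theorem 6: `E_n` satisfies Richards' conditions 2 and 3 with `d_n = n − 2` — the tree's `sahiE_snoc_one`,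
`sahiE_const_one`.)

STATUS OF RICHARDS' THEOREMS 1.1/1.3 (recorded, not used): the printed proofs are regarded as incomplete —
[LiebSahi2021, p. 3] "[rich] contains two 'proofs' of the positivity of κ′₃, κ′₄, κ′₅ … both proofs have
essential gaps.  Thus … Conjecture 1.1 remains a conjecture, even for n = 3,4,5".  Accordingly NOTHING in this
file asserts (1.7)–(1.9): `forall_conjCumulant_nonneg_iff_sahiPositive` only identifies the ASSERTION of
Theorem 1.1/1.3 for a given weight with order-`n` Sahi positivity (`SahiPositive μ n`, `Functional.lean`), i.e.
with Sahi's Conjecture 5 / Kahn's conjecture at that order.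

## What is formalised (everything PROVED; no named facts; axioms standard)

Richards' objects, over the tree's vocabulary (`ex μ`, set partitions of `Fin n` = Mathlib `OrderedFinpartition n`
as in `SetPartitionForm.lean`, blocks `PartitionForm.block`):
* `PartitionForm.corrProd μ f c = Π_{blocks B of c} E(Π_{i∈B} f_i)` — the correlation product `E_π` of
  [Sahi2008, (4)–(5)] = Richards' `P_λ(τ·f)`;
* `Richards2004.cumulant μ n f` = (2.20) and `Richards2004.conjCumulant μ n f` = (2.21)/(9), with
  `Richards2004.maxPart c = λ₁ = l(λ′)`;
* `Richards2004.conjCumulant_eq_sahiE` — **`κ′_n = E_n` for `1 ≤ n ≤ 5`** (every finite type, every weight, every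
  family; Sahi's argument verbatim: `prod_factorial_eq_maxPart`, "the other parts are 1 or 2");
  the displays (1.6) `conjCumulant_three`, (1.8) `conjCumulant_four` ((1.9) is `sahiE_five`), the covariance form
  of (1.7) `conjCumulant_three_eq_cov_form`, Corollary 1.2 as the implication `richards2004_cor12`
  (from `κ′₃ ≥ 0`, with `κ₃` written out as (1.5)), (2.18) for `κ′_m`, `m = 3,4,5`, `d_m = m − 2`
  (`conjCumulant_snoc_one`) and (2.19) for `2 ≤ m ≤ 5` (`conjCumulant_const_one_eq_zero`);
* `Richards2004.forall_conjCumulant_nonneg_iff_sahiPositive` — for `1 ≤ n ≤ 5` and any weight `μ` on a finite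
  preorder: (`κ′_n(f) ≥ 0` for all pointwise nonnegative monotone families) `↔ SahiPositive μ n`;
* **`n = 6`**: `Richards2004.conjCumulant_const_one_six` — for a probability weight, `κ′_6(1,…,1) = 20`
  (Richards' "κ′₆(1,…,1) > 0", Sahi p. 214), whence `conjCumulant_six_ne_sahiE_six` (`κ′_6 ≠ E_6`, as
  `E_6(1,…,1) = 0`); also `κ′_7(1,…,1) = 70`; the differing coefficient at type `(3,3)`:
  `coeff_type_three_three` (`c′ = −2`, `c = −4`);
* `Richards2004.cumulant_eq_conjCumulant_of_le_two` (`κ_n = κ′_n = E_n` for `n ≤ 2`); **`Richards2004.cumulant_three`**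
  — (1.5) explicitly (the five set partitions of `[3]` sorted by type, `PartitionForm.partList_three`, a kernel type
  count), `cumulant_three_eq_conjCumulant_three_sub` (`κ₃ = κ′₃ − [E(f₁f₂f₃) − E(f₁)E(f₂)E(f₃)]`, so `E₃` is not
  the third cumulant) and `richards2004_cor12'` (Cor. 1.2 with `κ₃` = `cumulant`);
* [LiebSahi2021, p. 3] "an easy example shows that the inequality already fails for `κ₃`", made explicit:
  `cumulant_three_idem` (`κ₃(f,f,f) = p(1−p)(1−2p)` for `f = f²`, `p = E f`), `conjCumulant_three_idem`
  (`κ′₃(f,f,f) = p(1−p)(2−p)`), `cumulant_three_idem_neg` (`< 0` for `1/2 < p < 1`), and the two-point chain with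
  `μ(true) = 2/3`, `f = 1_{true}`: **`liebSahi_cumulant_three_fails`** (`κ₃ = −2/27`, `E₃ = κ′₃ = 8/27`, `μ` FKG, `f`
  nonnegative increasing), `exists_cumulant_three_neg`.
Tool (generic, kernel-computable): `PartitionForm.listTypeSum n g` with **`PartitionForm.sum_partList`**:
`Σ_{c : OrderedFinpartition n} g(block sizes of c) = listTypeSum n g` — the set partitions of `n + 1` points are
those of `n` points with the new point as a singleton or inserted into one block (Mathlib
`OrderedFinpartition.extendEquiv`, the device of [LiebSahi2021, Prop. 3.3]); type sums such as `κ′_n(1,…,1)`,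
`E_n(1,…,1)`, Bell numbers are then evaluated by `decide`.

Motivation (cell prim-sahi, crux `stmt-CriticalPhenomena-4575`, bundle papers/CriticalPhenomena/sahi-implies-
continuity): the bundle's §2 distinguishes `E_n` from cumulants and cites Richards' (1.7) as the first appearance
of `C₃`; this file makes "Richards' (1.7)/(1.8)/(1.9) are literally `E₃, E₄, E₅ ≥ 0`" and "the coincidence stops
at `n = 6`" tree theorems.
-/

namespace Literature.Combinatorics.Sahi2008

open Finset Function

namespace PartitionForm

/-! ### A kernel-computable evaluator for type sums over set partitions -/

/-- **Type sums over set partitions, computably.**  `listTypeSum n g` is `Σ_π g(block sizes of π)` over the set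
partitions `π` of an `n`-set, computed by the recursion "a set partition of `n + 1` points is a set partition of
`n` points with the new point added as a singleton block or inserted into one of its blocks" (the lists are the
block sizes in Mathlib's canonical block order; see `sum_partList`). [cite: LiebSahi2021, Prop. 3.3 (proof: removing `n` from its cycle); Sahi2008, eq. (5) (p. 211)] -/
def listTypeSum {R : Type*} [AddCommMonoid R] : ℕ → (List ℕ → R) → R
  | 0, g => g []
  | n + 1, g => listTypeSum n fun l => g (1 :: l) + ∑ i ∈ range l.length, g (l.set i (l.getD i 0 + 1))

/-- Sahi's coefficient `c_λ = (−1)^{l(λ)−1} Π_i (λ_i − 1)!` of (6), on a list of block sizes. [cite: Sahi2008, eq. (6) (p. 211)] -/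
def sahiCoeffL (l : List ℕ) : ℤ := (-1) ^ (l.length - 1) * (l.map fun b => ((b - 1).factorial : ℤ)).prod

/-- Richards' coefficient `c′_λ = (−1)^{l(λ)−1} (l(λ′) − 1)! = (−1)^{l(λ)−1} (λ₁ − 1)!` of the conjugate cumulant,
on a list of block sizes. [cite: Richards2004, eq. (2.21); Sahi2008, eq. (9) (p. 213)] -/
def conjCoeffL (l : List ℕ) : ℤ := (-1) ^ (l.length - 1) * ((l.foldr max 0 - 1).factorial : ℤ)

/-- The cumulant coefficient `(−1)^{l(λ)−1} (l(λ) − 1)!`, on a list of block sizes. [cite: Richards2004, eq. (2.20); Sahi2008, p. 213] -/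
def cumCoeffL (l : List ℕ) : ℤ := (-1) ^ (l.length - 1) * ((l.length - 1).factorial : ℤ)

/-- **The two coefficient systems differ first at type `(3,3)`**: `c′_{(3,3)} = −(2!) = −2` while
`c_{(3,3)} = −(2!·2!) = −4` ("for `n = 6` … the two functions differ in the coefficient of `E_(3,3)`").
[cite: Sahi2008, p. 214] -/
theorem coeff_type_three_three : conjCoeffL [3, 3] = -2 ∧ sahiCoeffL [3, 3] = -4 := by decide

/-- Bell numbers `1, 1, 2, 5, 15, 52, 203` as type sums of the constant `1` (sanity check of the evaluator). [folklore] -/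
example : (List.range 7).map (fun n => listTypeSum n fun _ => (1 : ℤ)) = [1, 1, 2, 5, 15, 52, 203] := by decide

/-- `Σ_{π ⊢ [6]} c′_{λ(π)} = 20` and `Σ_{π ⊢ [7]} c′_{λ(π)} = 70` (Richards: "it appears to us that
`κ′_m(1,…,1) > 0` for all `m ≥ 6`"), while Sahi's coefficients sum to `0` (`E_n(1,…,1) = 0`, his Theorem 6).
[cite: Richards2004, p. 1521; Sahi2008, p. 214] -/
theorem listTypeSum_conjCoeffL_six : listTypeSum 6 conjCoeffL = 20 ∧ listTypeSum 7 conjCoeffL = 70 ∧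
    listTypeSum 6 sahiCoeffL = 0 ∧ listTypeSum 6 cumCoeffL = 0 := by decide

/-- Additive maps pass through the evaluator. [folklore] -/
private theorem map_listTypeSum {R S : Type*} [AddCommMonoid R] [AddCommMonoid S] (φ : R →+ S) :
    ∀ (n : ℕ) (g : List ℕ → R), φ (listTypeSum n g) = listTypeSum n (fun l => φ (g l))
  | 0, g => rfl
  | n + 1, g => by
    simp only [listTypeSum]
    rw [map_listTypeSum φ n]
    simp only [map_add, map_sum]

end PartitionForm

noncomputable section

open PartitionForm

variable {α : Type*} [Fintype α]

namespace PartitionForm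

variable {n : ℕ}

/-! ### Block-size lists and correlation products of a set partition -/

/-- The list of block sizes `(|π_1|,…,|π_l|)` of a set partition, in Mathlib's canonical block order
(its underlying multiset is the type `λ(π)`). [cite: Sahi2008, eq. (5) (p. 211) (the type λ(π))] -/
def partList (c : OrderedFinpartition n) : List ℕ := List.ofFn c.partSize

/-- The block-size list has `l(π)` entries. [cite: Sahi2008, eq. (5) (p. 211)] -/
theorem length_partList (c : OrderedFinpartition n) : (partList c).length = c.length := by
  rw [partList, List.length_ofFn]

/-- Entries of the block-size list. [folklore] -/
private theorem getD_partList (c : OrderedFinpartition n) (k : Fin c.length) :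
    (partList c).getD k 0 = c.partSize k := by
  rw [partList, List.getD_eq_getElem _ _ (by rw [List.length_ofFn]; exact k.2), List.getElem_ofFn]

/-- `ofFn` of an updated function is the updated list. [folklore] -/
private theorem ofFn_update {l : ℕ} (p : Fin l → ℕ) (k : Fin l) (v : ℕ) :
    List.ofFn (update p k v) = (List.ofFn p).set k v := by
  apply List.ext_getElem
  · simp
  · intro i h₁ h₂
    rw [List.getElem_ofFn, List.getElem_set, List.getElem_ofFn, update_apply]
    have : ((⟨i, by simpa using h₁⟩ : Fin l) = k) ↔ ((k : ℕ) = i) := by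
      rw [Fin.ext_iff]; exact eq_comm
    simp only [this]

/-- New singleton block: the block sizes get a leading `1`. [cite: LiebSahi2021, Prop. 3.3 (proof)] -/
theorem partList_extendLeft (c : OrderedFinpartition n) : partList c.extendLeft = 1 :: partList c := by
  unfold partList
  rw [OrderedFinpartition.extendLeft_partSize]
  exact List.ofFn_succ

/-- New point inserted into block `k`: that block size goes up by one. [cite: LiebSahi2021, Prop. 3.3 (proof)] -/
theorem partList_extendMiddle (c : OrderedFinpartition n) (k : Fin c.length) :
    partList (c.extendMiddle k) = (partList c).set k (c.partSize k + 1) := by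
  unfold partList
  rw [OrderedFinpartition.extendMiddle_partSize]
  exact ofFn_update _ _ _

/-- Sums over the set partitions of `n + 1` points split along Mathlib's `extendEquiv` ("new point as a
singleton, or inserted into block `k`"). [cite: LiebSahi2021, Prop. 3.3 (proof: the bijections S⁽ⁱ⁾ → S_{n−1}, S⁽ⁿ⁾ → S_{n−1})] -/
theorem sum_eq_sum_extend {R : Type*} [AddCommMonoid R] (G : OrderedFinpartition (n + 1) → R) :
    ∑ c', G c' = ∑ c : OrderedFinpartition n, (G c.extendLeft + ∑ k : Fin c.length, G (c.extendMiddle k)) := by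
  rw [← Fintype.sum_equiv (OrderedFinpartition.extendEquiv n) (fun p => G (p.1.extend p.2)) G (fun p => rfl),
    Fintype.sum_sigma]
  simp_rw [Fintype.sum_option, OrderedFinpartition.extend_none, OrderedFinpartition.extend_some]

/-- **The evaluator is correct**: `Σ_{π} g(block sizes of π) = listTypeSum n g` over the set partitions of
`Fin n`. [cite: LiebSahi2021, Prop. 3.3 (proof); Sahi2008, eq. (5) (p. 211)] -/
theorem sum_partList {R : Type*} [AddCommMonoid R] :
    ∀ (n : ℕ) (g : List ℕ → R), ∑ c : OrderedFinpartition n, g (partList c) = listTypeSum n g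
  | 0, g => by
    rw [Fintype.sum_unique]
    have hlen : (default : OrderedFinpartition 0).length = 0 :=
      Nat.eq_zero_of_le_zero (default : OrderedFinpartition 0).length_le
    have h : partList (default : OrderedFinpartition 0) = [] :=
      List.eq_nil_of_length_eq_zero (by rw [length_partList, hlen])
    rw [h]
    rfl
  | n + 1, g => by
    rw [sum_eq_sum_extend]
    simp_rw [partList_extendLeft, partList_extendMiddle]
    rw [listTypeSum, ← sum_partList n]
    refine sum_congr rfl fun c _ => ?_
    congr 1
    rw [length_partList, ← Fin.sum_univ_eq_sum_range (fun i => g ((partList c).set i ((partList c).getD i 0 + 1)))]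
    refine sum_congr rfl fun k _ => ?_
    rw [getD_partList]

/-- **The correlation product** `E_π = Π_{i=1}^{l} E_{π_i}`, `E_τ = E(Π_{i∈τ} f_i)`, of a set partition `π`
(= Richards' `P_λ(τ·(f₁,…,f_m))`). [cite: Sahi2008, eqs. (4)–(5) (p. 211); Richards2004, p. 1520 (P_λ)] -/
def corrProd (μ : α → ℝ) (f : Fin n → α → ℝ) (c : OrderedFinpartition n) : ℝ :=
  ∏ m : Fin c.length, ex μ (∏ x ∈ block c m, f x)

/-- New singleton block: `E_π` picks up the factor `E(f_0)`. [cite: LiebSahi2021, Prop. 3.3 (proof: "E_σ = E_{σ̄}·E(f)")] -/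
theorem corrProd_extendLeft (μ : α → ℝ) (F : Fin (n + 1) → α → ℝ) (c : OrderedFinpartition n) :
    corrProd μ F c.extendLeft = ex μ (F 0) * corrProd μ (Fin.tail F) c := by
  unfold corrProd
  show ∏ m : Fin (c.length + 1), ex μ (∏ x ∈ block c.extendLeft m, F x) = _
  rw [Fin.prod_univ_succ]
  congr 1
  · rw [block_extendLeft_zero, prod_singleton]
  · refine prod_congr rfl fun m _ => ?_
    rw [block_extendLeft_succ, prod_map]
    rfl

/-- New point inserted into block `k`: that block's moment becomes `E(f_0 · Π_{block} f)`.
[cite: LiebSahi2021, Prop. 3.3 (proof: "E_σ(…,f) = E_{σ̄}(…, fⁱf, …)")] -/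
theorem corrProd_extendMiddle (μ : α → ℝ) (F : Fin (n + 1) → α → ℝ) (c : OrderedFinpartition n)
    (k : Fin c.length) :
    corrProd μ F (c.extendMiddle k) =
      ex μ (F 0 * ∏ x ∈ block c k, Fin.tail F x) * ∏ m ∈ univ.erase k, ex μ (∏ x ∈ block c m, Fin.tail F x) := by
  unfold corrProd
  show ∏ m : Fin c.length, ex μ (∏ x ∈ block (c.extendMiddle k) m, F x) = _
  rw [← mul_prod_erase univ _ (mem_univ k)]
  congr 1
  · rw [block_extendMiddle_self, prod_insert (by simp), prod_map]
    rfl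
  · refine prod_congr rfl fun m hm => ?_
    rw [block_extendMiddle_ne c k (ne_of_mem_erase hm), prod_map]
    rfl

/-- For the constant family `1` under a probability weight every `E_π` is `1` (`P_λ(1,…,1) = 1`, the reading of
(2.19) as `Σ_λ card(D(λ)) c_λ = 0`). [cite: Richards2004, eq. (2.19) (p. 1521)] -/
theorem corrProd_const_one {μ : α → ℝ} (hμ : ∑ x, μ x = 1) (c : OrderedFinpartition n) :
    corrProd μ (fun _ : Fin n => (1 : α → ℝ)) c = 1 := by
  unfold corrProd
  refine prod_eq_one fun m _ => ?_
  simp only [prod_const_one]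
  exact ex_one hμ

/-- The parts of a set partition of `Fin n` add up to `n` (the weight `|λ| = λ₁ + λ₂ + ⋯` of its type is `n`).
[cite: Richards2004, p. 1520 (weight of a partition)] -/
theorem sum_partSize (c : OrderedFinpartition n) : ∑ m, c.partSize m = n := by
  have h := c.sum_sigma_eq_sum (fun _ => (1 : ℕ))
  simpa using h

/-- Sahi's set-partition sum written with `corrProd`: `E_n = Σ_π (−1)^{l−1} (Π_i (|π_i|−1)!) · E_π`.
[cite: Sahi2008, eqs. (4)–(7) (p. 211)] -/
theorem sahiESetPartition_eq_sum_corrProd (μ : α → ℝ) (n : ℕ) (f : Fin n → α → ℝ) :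
    sahiESetPartition μ n f =
      ∑ c : OrderedFinpartition n,
        ((-1 : ℝ) ^ (c.length - 1) * ∏ m : Fin c.length, ((c.partSize m - 1).factorial : ℝ)) * corrProd μ f c := by
  rw [sahiESetPartition_eq_sum_term]
  refine sum_congr rfl fun c _ => ?_
  unfold term factor corrProd
  rw [prod_mul_distrib, mul_assoc]

/-- `E_n(1,…,1) = Σ_π c_{λ(π)}` for a probability weight, as a type sum (`= 0` for `n ≥ 2`, Sahi's Theorem 6,
cf. `sahiE_const_one`). [cite: Sahi2008, Thm. 6 (p. 214) and eq. (6)] -/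
theorem sahiESetPartition_const_one {μ : α → ℝ} (hμ : ∑ x, μ x = 1) (n : ℕ) :
    sahiESetPartition μ n (fun _ : Fin n => (1 : α → ℝ)) = ((listTypeSum n sahiCoeffL : ℤ) : ℝ) := by
  rw [sahiESetPartition_eq_sum_corrProd, show ((listTypeSum n sahiCoeffL : ℤ) : ℝ) =
    (Int.castRingHom ℝ : ℤ →+ ℝ) (listTypeSum n sahiCoeffL) from rfl, map_listTypeSum, ← sum_partList]
  refine sum_congr rfl fun c _ => ?_
  rw [corrProd_const_one hμ, mul_one]
  simp only [sahiCoeffL, AddMonoidHom.coe_coe, eq_intCast, Int.cast_mul, Int.cast_pow, Int.cast_neg,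
    Int.cast_one, length_partList]
  congr 1
  simp only [partList, List.map_ofFn, List.prod_ofFn, Function.comp_apply, Int.cast_prod, Int.cast_natCast]

end PartitionForm

namespace Richards2004

variable {n : ℕ}

/-! ### The objects: `λ₁`, cumulants (2.20), conjugate cumulants (2.21) -/

/-- The largest part `λ₁` of the type of a set partition, `= l(λ′)` for the conjugate partition `λ′`
("`λ′₁ = l(λ)`" applied to `λ′`, with `(λ′)′ = λ`). [cite: Richards2004, p. 1520; Sahi2008, p. 213 ("l(λ′) = λ₁")] -/
def maxPart (c : OrderedFinpartition n) : ℕ := univ.sup c.partSize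

/-- `λ₁` computed on the block-size list. [cite: Sahi2008, p. 213 ("l(λ′) = λ₁")] -/
theorem maxPart_eq_foldr (c : OrderedFinpartition n) : maxPart c = (partList c).foldr max 0 := by
  rw [maxPart, sup_def, Fin.univ_val_map, Multiset.sup_coe]
  rfl

/-- **The `n`th-order cumulant** `κ_n(f₁,…,f_n) = Σ_{λ⊢n} (−1)^{l(λ)−1} (l(λ)−1)! Σ_{τ∈D(λ)} P_λ(τ·f)`, i.e. the
sum over set partitions `π` of `(−1)^{l(π)−1}(l(π)−1)!·E_π`. [cite: Richards2004, eq. (2.20) (p. 1521); Sahi2008, p. 213] -/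
def cumulant (μ : α → ℝ) (n : ℕ) (f : Fin n → α → ℝ) : ℝ :=
  ∑ c : OrderedFinpartition n, ((-1 : ℝ) ^ (c.length - 1) * ((c.length - 1).factorial : ℝ)) * corrProd μ f c

/-- **Richards' `n`th-order conjugate cumulant** `κ′_n(f₁,…,f_n) = Σ_{λ⊢n} (−1)^{l(λ)−1} (l(λ′)−1)! Σ_{τ∈D(λ)}
P_λ(τ·f)` = `Σ_π (−1)^{l(π)−1} (λ₁(π)−1)!·E_π` (Sahi's `c′_λ E_λ`, (9)). [cite: Richards2004, eq. (2.21) (p. 1521); Sahi2008, eq. (9) (p. 213)] -/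
def conjCumulant (μ : α → ℝ) (n : ℕ) (f : Fin n → α → ℝ) : ℝ :=
  ∑ c : OrderedFinpartition n, ((-1 : ℝ) ^ (c.length - 1) * ((maxPart c - 1).factorial : ℝ)) * corrProd μ f c

/-! ### Sahi's comparison: `c_λ = c′_λ` for `λ ⊢ n ≤ 5`, hence `κ′_n = E_n` for `n ≤ 5` -/

/-- "if `λ` is a partition of `n ≤ 5`, then the second and subsequent parts of `λ` are either 2 or 1": a part
other than a largest one is at most `2`. [cite: Sahi2008, p. 213] -/
theorem partSize_le_two_of_ne (h5 : n ≤ 5) (c : OrderedFinpartition n) {m m₀ : Fin c.length}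
    (hmax : c.partSize m ≤ c.partSize m₀) (hm : m ≠ m₀) : c.partSize m ≤ 2 := by
  have hsub : ({m, m₀} : Finset (Fin c.length)) ⊆ univ := subset_univ _
  have h2 : c.partSize m + c.partSize m₀ ≤ n := by
    have h := sum_le_sum_of_subset (f := c.partSize) hsub
    rw [sum_pair hm, sum_partSize] at h
    exact h
  omega

/-- **`c_λ = c′_λ` for all `λ ⊢ n ≤ 5`**: `Π_i (λ_i − 1)! = (λ₁ − 1)!`, because "`(λ_i − 1)! = 1` for all `i ≥ 2`".
[cite: Sahi2008, p. 213] -/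
theorem prod_factorial_eq_maxPart (h5 : n ≤ 5) (c : OrderedFinpartition n) :
    (∏ m : Fin c.length, ((c.partSize m - 1).factorial : ℝ)) = ((maxPart c - 1).factorial : ℝ) := by
  rcases Nat.eq_zero_or_pos c.length with hl | hl
  · -- no blocks (only at `n = 0`): both sides are `1`
    haveI : IsEmpty (Fin c.length) := by rw [hl]; infer_instance
    rw [maxPart, univ_eq_empty, sup_empty, Finset.prod_empty]
    simp
  · haveI : Nonempty (Fin c.length) := by rw [← Fin.pos_iff_nonempty]; exact hl
    obtain ⟨m₀, -, hm₀⟩ := exists_mem_eq_sup (univ : Finset (Fin c.length)) univ_nonempty c.partSize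
    rw [maxPart, hm₀, ← mul_prod_erase univ _ (mem_univ m₀)]
    rw [prod_eq_one, mul_one]
    intro m hm
    have hne : m ≠ m₀ := ne_of_mem_erase hm
    have hle : c.partSize m ≤ c.partSize m₀ := by rw [← hm₀]; exact le_sup (mem_univ m)
    have h2 := partSize_le_two_of_ne h5 c hle hne
    have h1 := c.partSize_pos m
    have : c.partSize m - 1 = 0 ∨ c.partSize m - 1 = 1 := by omega
    rcases this with h | h <;> simp [h]

/-- `κ′_n` equals Sahi's set-partition sum (7) for `n ≤ 5`. [cite: Sahi2008, p. 213] -/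
theorem conjCumulant_eq_sahiESetPartition (h5 : n ≤ 5) (μ : α → ℝ) (f : Fin n → α → ℝ) :
    conjCumulant μ n f = sahiESetPartition μ n f := by
  rw [conjCumulant, sahiESetPartition_eq_sum_corrProd]
  refine sum_congr rfl fun c _ => ?_
  rw [prod_factorial_eq_maxPart h5]

/-- **`κ′_n = E_n` for `n ≤ 5`** ("by an amazing coincidence"): Richards' conjugate cumulant coincides with
Sahi's `E_n` (the tree's `sahiE`) for `1 ≤ n ≤ 5`, on every finite type, for every weight and every family
(at `n = 0` the tree's junk value `E_0 = 0` is not `κ′_0 = 1`).  In particular (1.6), (1.8), (1.9) are the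
tree's `sahiE_three`, `sahiE_four`, `sahiE_five`. [cite: Sahi2008, p. 213; Richards2004, eqs. (1.6), (1.8), (1.9), (2.21)] -/
theorem conjCumulant_eq_sahiE (h1 : 1 ≤ n) (h5 : n ≤ 5) (μ : α → ℝ) (f : Fin n → α → ℝ) :
    conjCumulant μ n f = sahiE μ n f := by
  obtain ⟨k, rfl⟩ : ∃ k, n = k + 1 := ⟨n - 1, by omega⟩
  rw [sahiE_eq_sahiESetPartition, conjCumulant_eq_sahiESetPartition h5]

/-- **(1.6)**: `κ′₃(f₁,f₂,f₃) = 2E(f₁f₂f₃) − [E(f₁f₂)E(f₃) + E(f₁f₃)E(f₂) + E(f₁)E(f₂f₃)] + E(f₁)E(f₂)E(f₃)`.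
[cite: Richards2004, eq. (1.6) (p. 1512)] -/
theorem conjCumulant_three (μ : α → ℝ) (f₁ f₂ f₃ : α → ℝ) :
    conjCumulant μ 3 ![f₁, f₂, f₃] =
      2 * ex μ (f₁ * f₂ * f₃) - (ex μ (f₁ * f₂) * ex μ f₃ + ex μ (f₁ * f₃) * ex μ f₂ + ex μ f₁ * ex μ (f₂ * f₃))
        + ex μ f₁ * ex μ f₂ * ex μ f₃ := by
  rw [conjCumulant_eq_sahiE (by norm_num) (by norm_num), sahiE_three]
  ring

/-- **(1.8)**: `κ′₄ = 6E(f₁f₂f₃f₄) − 2[E(f₁f₂f₃)E(f₄) + ⋯] − [E(f₁f₂)E(f₃f₄) + ⋯] + [E(f₁f₂)E(f₃)E(f₄) + ⋯]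
− E(f₁)E(f₂)E(f₃)E(f₄)` (the brackets being the sums over all distinct terms of the indicated shape, p. 1513).
[cite: Richards2004, eq. (1.8) (p. 1513)] -/
theorem conjCumulant_four (μ : α → ℝ) (f₁ f₂ f₃ f₄ : α → ℝ) :
    conjCumulant μ 4 ![f₁, f₂, f₃, f₄] =
      6 * ex μ (f₁ * f₂ * f₃ * f₄)
      - 2 * (ex μ (f₁ * f₂ * f₃) * ex μ f₄ + ex μ (f₁ * f₂ * f₄) * ex μ f₃ + ex μ (f₁ * f₃ * f₄) * ex μ f₂
          + ex μ f₁ * ex μ (f₂ * f₃ * f₄))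
      - (ex μ (f₁ * f₂) * ex μ (f₃ * f₄) + ex μ (f₁ * f₃) * ex μ (f₂ * f₄) + ex μ (f₁ * f₄) * ex μ (f₂ * f₃))
      + (ex μ (f₁ * f₂) * ex μ f₃ * ex μ f₄ + ex μ (f₁ * f₃) * ex μ f₂ * ex μ f₄ + ex μ (f₁ * f₄) * ex μ f₂ * ex μ f₃
          + ex μ f₁ * ex μ (f₂ * f₃) * ex μ f₄ + ex μ f₁ * ex μ (f₂ * f₄) * ex μ f₃ + ex μ f₁ * ex μ f₂ * ex μ (f₃ * f₄))
      - ex μ f₁ * ex μ f₂ * ex μ f₃ * ex μ f₄ := by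
  rw [conjCumulant_eq_sahiE (by norm_num) (by norm_num), sahiE_four]
  ring

/-- **The covariance form of (1.7)**: "`(1.7)` can be rewritten as `Cov(f₁f₂,f₃) − E(f₁)Cov(f₂,f₃) + Cov(f₁f₃,f₂) ≥ 0`"
— here the identity `κ′₃ = [E(f₁f₂f₃) − E(f₁f₂)E(f₃)] − E(f₁)[E(f₂f₃) − E(f₂)E(f₃)] + [E(f₁f₃f₂) − E(f₁f₃)E(f₂)]`
(covariances under a probability weight, written out). [cite: Richards2004, p. 1512] -/
theorem conjCumulant_three_eq_cov_form (μ : α → ℝ) (f₁ f₂ f₃ : α → ℝ) :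
    conjCumulant μ 3 ![f₁, f₂, f₃] =
      (ex μ (f₁ * f₂ * f₃) - ex μ (f₁ * f₂) * ex μ f₃) - ex μ f₁ * (ex μ (f₂ * f₃) - ex μ f₂ * ex μ f₃)
        + (ex μ (f₁ * f₃ * f₂) - ex μ (f₁ * f₃) * ex μ f₂) := by
  rw [conjCumulant_three, mul_right_comm f₁ f₃ f₂]
  ring

/-- **Corollary 1.2, as the implication from (1.7)**: if `κ′₃(f₁,f₂,f₃) ≥ 0` then
`κ₃(f₁,f₂,f₃) ≥ −[E(f₁f₂f₃) − E(f₁)E(f₂)E(f₃)]`, the cumulant `κ₃` being written out as in (1.5):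
`E(f₁f₂f₃) − [E(f₁f₂)E(f₃) + E(f₁f₃)E(f₂) + E(f₁)E(f₂f₃)] + 2E(f₁)E(f₂)E(f₃)` (`κ₃ = κ′₃ − [E(f₁f₂f₃) − E(f₁)E(f₂)E(f₃)]`).
The hypothesis (1.7) itself is Theorem 1.1's assertion, NOT proved here or in print (see the module docstring).
[cite: Richards2004, Cor. 1.2 and eq. (1.5) (p. 1512)] -/
theorem richards2004_cor12 {μ : α → ℝ} {f₁ f₂ f₃ : α → ℝ} (h : 0 ≤ conjCumulant μ 3 ![f₁, f₂, f₃]) :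
    -(ex μ (f₁ * f₂ * f₃) - ex μ f₁ * ex μ f₂ * ex μ f₃) ≤
      ex μ (f₁ * f₂ * f₃) - (ex μ (f₁ * f₂) * ex μ f₃ + ex μ (f₁ * f₃) * ex μ f₂ + ex μ f₁ * ex μ (f₂ * f₃))
        + 2 * (ex μ f₁ * ex μ f₂ * ex μ f₃) := by
  rw [conjCumulant_three] at h
  linarith

/-- **(2.18) for `κ′_m`, `m = 3, 4, 5`, with `d_m = m − 2`**: `κ′_m(f₁,…,f_{m−1},1) = (m−2)·κ′_{m−1}(f₁,…,f_{m−1})`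
for a probability weight (here `m = k + 2`; = Sahi's Theorem 6 for `E_n` transported along `κ′_n = E_n`).
[cite: Richards2004, p. 1521 ("for m = 3, 4, 5, the κ′_m satisfy (2.18) with d_m = m − 2"); Sahi2008, Thm. 6 (p. 214)] -/
theorem conjCumulant_snoc_one {μ : α → ℝ} (hμ : ∑ x, μ x = 1) (k : ℕ) (hk : k + 2 ≤ 5)
    (g : Fin (k + 1) → α → ℝ) :
    conjCumulant μ (k + 2) (Fin.snoc g 1 : Fin (k + 2) → α → ℝ) = k * conjCumulant μ (k + 1) g := by
  rw [conjCumulant_eq_sahiE (by omega) hk, conjCumulant_eq_sahiE (by omega) (by omega), sahiE_snoc_one hμ]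

/-- **(2.19) for `κ′_m`, `2 ≤ m ≤ 5`**: `κ′_m(1,…,1) = 0` for a probability weight (here `m = k + 2`).
[cite: Richards2004, p. 1521 ("the coefficients c_λ … satisfy (2.19)", m = 2,…,5); Sahi2008, Thm. 6 (p. 214)] -/
theorem conjCumulant_const_one_eq_zero {μ : α → ℝ} (hμ : ∑ x, μ x = 1) (k : ℕ) (hk : k + 2 ≤ 5) :
    conjCumulant μ (k + 2) (fun _ : Fin (k + 2) => (1 : α → ℝ)) = 0 := by
  rw [conjCumulant_eq_sahiE (by omega) hk, sahiE_const_one hμ]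

/-- **Richards' inequalities (1.7)/(1.8)/(1.9) ARE order-`n` Sahi positivity** (`n = 3, 4, 5`; also `n = 1, 2`):
for a weight `μ` on a finite preorder, "`κ′_n(f₁,…,f_n) ≥ 0` for all pointwise nonnegative monotone
`f₁,…,f_n`" is the tree's `SahiPositive μ n` — the assertion of [Richards2004, Thms. 1.1/1.3] for `μ` is Sahi's
Conjecture 5 / Kahn's conjecture at order `n` for `μ` (one open statement; the printed proofs of Thms. 1.1/1.3
are regarded as incomplete, [LiebSahi2021, p. 3]).  Nothing is asserted about either side.
[cite: Richards2004, Thm. 1.1 (1.7) and Thm. 1.3 (1.8)–(1.9); Sahi2008, p. 213 and Conj. 5 (p. 212); LiebSahi2021, p. 3] -/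
theorem forall_conjCumulant_nonneg_iff_sahiPositive [Preorder α] (μ : α → ℝ) (h1 : 1 ≤ n) (h5 : n ≤ 5) :
    (∀ f : Fin n → α → ℝ, (∀ i x, 0 ≤ f i x) → (∀ i, Monotone (f i)) → 0 ≤ conjCumulant μ n f) ↔
      SahiPositive μ n := by
  simp only [SahiPositive, conjCumulant_eq_sahiE h1 h5]

/-! ### Constant functions: `κ′_n(1,…,1)` is a type sum; `n = 6` -/

/-- `κ′_n(1,…,1) = Σ_π c′_{λ(π)}` for a probability weight — a pure type sum, evaluated by `listTypeSum`.
[cite: Richards2004, eq. (2.19)/(2.21) (p. 1521); Sahi2008, p. 214] -/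
theorem conjCumulant_const_one {μ : α → ℝ} (hμ : ∑ x, μ x = 1) (n : ℕ) :
    conjCumulant μ n (fun _ : Fin n => (1 : α → ℝ)) = ((listTypeSum n conjCoeffL : ℤ) : ℝ) := by
  rw [conjCumulant, show ((listTypeSum n conjCoeffL : ℤ) : ℝ) =
    (Int.castRingHom ℝ : ℤ →+ ℝ) (listTypeSum n conjCoeffL) from rfl, map_listTypeSum, ← sum_partList]
  refine sum_congr rfl fun c _ => ?_
  rw [corrProd_const_one hμ, mul_one]
  simp only [conjCoeffL, AddMonoidHom.coe_coe, eq_intCast, Int.cast_mul, Int.cast_pow, Int.cast_neg,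
    Int.cast_one, Int.cast_natCast, length_partList, maxPart_eq_foldr]

/-- **`κ′₆(1,1,1,1,1,1) = 20 > 0`** for every probability weight ("Richards observed that the inequality
`κ′₆ ≥ 0` is not sharp, since one has `κ′₆(1,1,1,1,1,1) > 0`"; Richards: "for `m ≥ 6`, it appears that the
conjugate cumulants do not satisfy (2.19)").  The value: by type, `120 − 144 − 90 + 90 − 20 + 120 − 40 + 15 − 45
+ 15 − 1 = 20` over the eleven partitions of `6` (kernel evaluation `listTypeSum_conjCoeffL_six`).
[cite: Sahi2008, p. 214; Richards2004, p. 1521] -/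
theorem conjCumulant_const_one_six {μ : α → ℝ} (hμ : ∑ x, μ x = 1) :
    conjCumulant μ 6 (fun _ : Fin 6 => (1 : α → ℝ)) = 20 := by
  rw [conjCumulant_const_one hμ, listTypeSum_conjCoeffL_six.1]
  norm_num

/-- `κ′₇(1,…,1) = 70 > 0` (the next instance of Richards' "it appears to us that `κ′_m(1,…,1) > 0` for all
`m ≥ 6`"; certified here for `m = 6, 7` only). [cite: Richards2004, p. 1521] -/
theorem conjCumulant_const_one_seven {μ : α → ℝ} (hμ : ∑ x, μ x = 1) :
    conjCumulant μ 7 (fun _ : Fin 7 => (1 : α → ℝ)) = 70 := by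
  rw [conjCumulant_const_one hμ, listTypeSum_conjCoeffL_six.2.1]
  norm_num

/-- **`κ′₆ ≠ E₆`**: for every probability weight the two functionals already differ on the constant family
`(1,…,1)` (`κ′₆ = 20`, `E₆ = 0` by Sahi's Theorem 6 / `sahiE_const_one`) — "since the two functions differ in
the coefficient of `E_(3,3)`" (`coeff_type_three_three`: the ten set partitions of type `(3,3)` carry `c′ = −2`
versus `c = −4`, and `10·(−2 − (−4)) = 20`). [cite: Sahi2008, p. 214] -/
theorem conjCumulant_six_ne_sahiE_six {μ : α → ℝ} (hμ : ∑ x, μ x = 1) :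
    conjCumulant μ 6 (fun _ : Fin 6 => (1 : α → ℝ)) ≠ sahiE μ 6 (fun _ : Fin 6 => (1 : α → ℝ)) := by
  rw [conjCumulant_const_one_six hμ, show (6 : ℕ) = 4 + 2 from rfl, sahiE_const_one hμ 4]
  norm_num

/-! ### Cumulants versus conjugate cumulants -/

/-- For `n ≤ 2` all three functionals agree: `κ_n = κ′_n` (`(l(λ)−1)! = (λ₁−1)! = 1` for `λ ⊢ n ≤ 2`), and
`κ′_n = E_n` (`conjCumulant_eq_sahiE`); at `n = 2` each is the covariance `E(f₁f₂) − E(f₁)E(f₂)` of the FKG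
inequality.  From `n = 3` on `κ_n ≠ κ′_n` ((1.5) vs (1.6): "reversing the order of … the coefficients").
[cite: Richards2004, eqs. (2.20)–(2.21) (p. 1521) and (1.5)–(1.6) (p. 1512)] -/
theorem cumulant_eq_conjCumulant_of_le_two (h2 : n ≤ 2) (μ : α → ℝ) (f : Fin n → α → ℝ) :
    cumulant μ n f = conjCumulant μ n f := by
  unfold cumulant conjCumulant
  refine sum_congr rfl fun c _ => ?_
  have hl : c.length - 1 ≤ 1 := by have := c.length_le; omega
  have hm : maxPart c - 1 ≤ 1 := by
    have : maxPart c ≤ n := Finset.sup_le fun m _ => c.partSize_le m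
    omega
  rw [Nat.factorial_eq_one.2 hl, Nat.factorial_eq_one.2 hm]

/-- `κ₂ = E₂ = E(f₁f₂) − E(f₁)E(f₂)`. [cite: Richards2004, eq. (2.20) (p. 1521); LiebSahi2021, eq. (1.1)] -/
theorem cumulant_two_eq_sahiE (μ : α → ℝ) (f : Fin 2 → α → ℝ) : cumulant μ 2 f = sahiE μ 2 f := by
  rw [cumulant_eq_conjCumulant_of_le_two le_rfl, conjCumulant_eq_sahiE (by norm_num) (by norm_num)]

end Richards2004

/-! ### Type facts by kernel evaluation; `E_π` for one-block and all-singleton partitions; `κ₃` explicitly -/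

namespace PartitionForm

variable {n : ℕ}

/-- **A property of block-size lists holds for every set partition of an `n`-set as soon as its failure count,
a type sum, evaluates to `0`** (the count is `listTypeSum n (if P then 0 else 1)`, a kernel computation).
[cite: Sahi2008, eq. (5) (p. 211) (the types λ(π)); LiebSahi2021, Prop. 3.3 (proof)] -/
theorem forall_partList_of_listTypeSum (n : ℕ) (P : List ℕ → Prop) [DecidablePred P]
    (h : listTypeSum n (fun l => if P l then (0 : ℕ) else 1) = 0) (c : OrderedFinpartition n) :
    P (partList c) := by
  have hs := sum_partList n (fun l => if P l then (0 : ℕ) else 1)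
  rw [h] at hs
  have hc := Finset.sum_eq_zero_iff.1 hs c (mem_univ c)
  by_contra hP
  simp [hP] at hc

/-- The five set partitions of a `3`-set have block-size lists `[3]`, `[1,1,1]`, `[1,2]` or `[2,1]` (types
`(3), (1,1,1), (2,1)`). [cite: Sahi2008, p. 213 (E₃ = 2E_(3) − E_(2,1) + E_(1,1,1))] -/
theorem partList_three (c : OrderedFinpartition 3) :
    partList c = [3] ∨ partList c = [1, 1, 1] ∨ partList c = [1, 2] ∨ partList c = [2, 1] :=
  forall_partList_of_listTypeSum 3
    (fun l => l = [3] ∨ l = [1, 1, 1] ∨ l = [1, 2] ∨ l = [2, 1]) (by decide) c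

/-- A block is the image of its increasing enumeration. [folklore] -/
private theorem block_eq_image' (c : OrderedFinpartition n) (m : Fin c.length) :
    block c m = univ.image (c.emb m) := by
  ext x
  rw [mem_block, mem_image]
  simp

/-- **`E_π` for the one-block partition** `π = {[n]}`: `E_π = E(f_0 ⋯ f_{n−1})` (the term `E_(n)`).
[cite: Sahi2008, eqs. (4)–(5) (p. 211)] -/
theorem corrProd_of_length_eq_one (μ : α → ℝ) (F : Fin n → α → ℝ) (c : OrderedFinpartition n)
    (h : c.length = 1) : corrProd μ F c = ex μ (∏ i, F i) := by
  haveI : Subsingleton (Fin c.length) := ⟨fun a b => Fin.ext (by have := a.2; have := b.2; omega)⟩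
  let m₀ : Fin c.length := ⟨0, by omega⟩
  have hsize : c.partSize m₀ = n := by
    have hs := sum_partSize c
    rwa [Fintype.sum_subsingleton _ m₀] at hs
  have hblock : ∀ m, block c m = univ := fun m => by
    rw [Subsingleton.elim m m₀]
    exact eq_univ_of_card _ (by rw [card_block, hsize, Fintype.card_fin])
  unfold corrProd
  rw [Fintype.prod_subsingleton _ m₀, hblock]

/-- **`E_π` for the all-singleton partition** `π = {{0},…,{n−1}}`: `E_π = Π_i E(f_i)` (the term `E_(1,…,1)`).
[cite: Sahi2008, eqs. (4)–(5) (p. 211)] -/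
theorem corrProd_of_partSize_eq_one (μ : α → ℝ) (F : Fin n → α → ℝ) (c : OrderedFinpartition n)
    (h : ∀ m, c.partSize m = 1) : corrProd μ F c = ∏ i, ex μ (F i) := by
  rw [← c.prod_sigma_eq_prod (fun i => ex μ (F i))]
  unfold corrProd
  refine prod_congr rfl fun m _ => ?_
  haveI : Subsingleton (Fin (c.partSize m)) :=
    ⟨fun a b => Fin.ext (by have := a.2; have := b.2; have := h m; omega)⟩
  let r₀ : Fin (c.partSize m) := ⟨0, by rw [h m]; exact Nat.zero_lt_one⟩
  rw [Fintype.prod_subsingleton _ r₀, block_eq_image',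
    prod_image fun a _ b _ hab => (c.emb_strictMono m).injective hab, Fintype.prod_subsingleton _ r₀]

end PartitionForm

namespace Richards2004

/-- The number of set partitions of `[3]` of type `(3)` and of type `(1,1,1)` is one each (kernel evaluation),
read in `ℝ`. [cite: Sahi2008, p. 213 (E₃ = 2E_(3) − E_(2,1) + E_(1,1,1))] -/
private theorem sum_ite_partList_three (l₀ : List ℕ) (h : listTypeSum 3 (fun l => if l = l₀ then (1 : ℕ) else 0) = 1) :
    ∑ c : OrderedFinpartition 3, (if partList c = l₀ then (1 : ℝ) else 0) = 1 := by
  have hs := sum_partList 3 (fun l => if l = l₀ then (1 : ℕ) else 0)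
  rw [h] at hs
  have hc := congrArg (fun k : ℕ => (k : ℝ)) hs
  simpa [Nat.cast_sum, Nat.cast_ite] using hc

/-- **(1.5), the third cumulant explicitly**: `κ₃(f₁,f₂,f₃) = E(f₁f₂f₃) − [E(f₁f₂)E(f₃) + E(f₁f₃)E(f₂)
+ E(f₁)E(f₂f₃)] + 2E(f₁)E(f₂)E(f₃)` — Richards' (2.20) at `n = 3` summed over the five set partitions of `[3]`
(types `(3)`: coefficient `0! = 1`; `(2,1)`: `−1! = −1`; `(1,1,1)`: `+2! = 2`).  Compare (1.6)/`sahiE_three`: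
`κ′₃ = E₃` carries `(2, −1, +1)` ("reversing the order of the absolute value of the coefficients"), so
`κ₃ = κ′₃ − [E(f₁f₂f₃) − E(f₁)E(f₂)E(f₃)]` (the identity behind Cor. 1.2). [cite: Richards2004, eqs. (1.5)–(1.6) and (2.20) (pp. 1512, 1521)] -/
theorem cumulant_three (μ : α → ℝ) (f₁ f₂ f₃ : α → ℝ) :
    cumulant μ 3 ![f₁, f₂, f₃] =
      ex μ (f₁ * f₂ * f₃) - (ex μ (f₁ * f₂) * ex μ f₃ + ex μ (f₁ * f₃) * ex μ f₂ + ex μ f₁ * ex μ (f₂ * f₃))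
        + 2 * (ex μ f₁ * ex μ f₂ * ex μ f₃) := by
  set F : Fin 3 → α → ℝ := ![f₁, f₂, f₃] with hF
  -- the one-block and all-singleton correlation products of `F`
  have hprod3 : ex μ (∏ i, F i) = ex μ (f₁ * f₂ * f₃) := by
    rw [Fin.prod_univ_three]; rfl
  have hprod111 : ∏ i, ex μ (F i) = ex μ f₁ * ex μ f₂ * ex μ f₃ := by
    rw [Fin.prod_univ_three]; rfl
  -- termwise: κ-coefficient = κ′-coefficient + [type (1,1,1)] − [type (3)] (times `E_π`)
  have key : ∀ c : OrderedFinpartition 3,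
      ((-1 : ℝ) ^ (c.length - 1) * ((c.length - 1).factorial : ℝ)) * corrProd μ F c =
        ((-1 : ℝ) ^ (c.length - 1) * ((maxPart c - 1).factorial : ℝ)) * corrProd μ F c +
          ((if partList c = [1, 1, 1] then (1 : ℝ) else 0) * (ex μ f₁ * ex μ f₂ * ex μ f₃) -
            (if partList c = [3] then (1 : ℝ) else 0) * ex μ (f₁ * f₂ * f₃)) := by
    intro c
    have hlen := length_partList c
    rw [maxPart_eq_foldr]
    rcases partList_three c with hc | hc | hc | hc <;> rw [hc] at hlen ⊢
    · -- type (3): one block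
      have hl : c.length = 1 := by simpa using hlen.symm
      rw [corrProd_of_length_eq_one μ F c hl, hprod3, hl]
      norm_num [Nat.factorial]
      ring
    · -- type (1,1,1): three singletons
      have hl : c.length = 3 := by simpa using hlen.symm
      have h1 : ∀ m, c.partSize m = 1 := by
        intro m
        have hm : (m : ℕ) < 3 := by have := m.2; omega
        rw [← getD_partList c m, hc]
        obtain ⟨k, hk⟩ := m
        simp only at hm ⊢
        interval_cases k <;> rfl
      rw [corrProd_of_partSize_eq_one μ F c h1, hprod111, hl]
      norm_num [Nat.factorial]
      ring
    · have hl : c.length = 2 := by simpa using hlen.symm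
      rw [hl]; norm_num [Nat.factorial]
    · have hl : c.length = 2 := by simpa using hlen.symm
      rw [hl]; norm_num [Nat.factorial]
  have hsplit : cumulant μ 3 F = conjCumulant μ 3 F +
      ((∑ c : OrderedFinpartition 3, (if partList c = [1, 1, 1] then (1 : ℝ) else 0)) * (ex μ f₁ * ex μ f₂ * ex μ f₃) -
        (∑ c : OrderedFinpartition 3, (if partList c = [3] then (1 : ℝ) else 0)) * ex μ (f₁ * f₂ * f₃)) := by
    unfold cumulant conjCumulant
    rw [sum_congr rfl fun c _ => key c, sum_add_distrib, sum_sub_distrib, ← sum_mul, ← sum_mul]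
  rw [hsplit, sum_ite_partList_three [1, 1, 1] (by decide), sum_ite_partList_three [3] (by decide), hF,
    conjCumulant_three]
  ring

/-- **`κ₃ = κ′₃ − [E(f₁f₂f₃) − E(f₁)E(f₂)E(f₃)]`** (p. 1512), so that (1.7) gives Corollary 1.2; with
`κ′₃ = E₃` this also reads `κ₃ = E₃ − [E(f₁f₂f₃) − E(f₁)E(f₂)E(f₃)]`: `E₃` is NOT the third cumulant.
[cite: Richards2004, Cor. 1.2 and eqs. (1.5)–(1.6) (p. 1512)] -/
theorem cumulant_three_eq_conjCumulant_three_sub (μ : α → ℝ) (f₁ f₂ f₃ : α → ℝ) :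
    cumulant μ 3 ![f₁, f₂, f₃] =
      conjCumulant μ 3 ![f₁, f₂, f₃] - (ex μ (f₁ * f₂ * f₃) - ex μ f₁ * ex μ f₂ * ex μ f₃) := by
  rw [cumulant_three, conjCumulant_three]
  ring

/-- **Corollary 1.2 with `κ₃` as the tree's `cumulant`**: `κ′₃(f₁,f₂,f₃) ≥ 0` implies
`κ₃(f₁,f₂,f₃) ≥ −[E(f₁f₂f₃) − E(f₁)E(f₂)E(f₃)]`. [cite: Richards2004, Cor. 1.2 (p. 1512)] -/
theorem richards2004_cor12' {μ : α → ℝ} {f₁ f₂ f₃ : α → ℝ} (h : 0 ≤ conjCumulant μ 3 ![f₁, f₂, f₃]) :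
    -(ex μ (f₁ * f₂ * f₃) - ex μ f₁ * ex μ f₂ * ex μ f₃) ≤ cumulant μ 3 ![f₁, f₂, f₃] := by
  rw [cumulant_three_eq_conjCumulant_three_sub]
  linarith

/-! ### "An easy example shows that the inequality already fails for `κ₃`" [LiebSahi2021, p. 3]

Lieb–Sahi, p. 3 (verbatim): "A natural first candidate for such an inequality is the cumulant (Ursell function)
`κ_n`, but an easy example shows that the inequality already fails for `κ₃`."  The example is not printed; the
simplest one is a single event (an idempotent `f = f²`, of mass `p = E f`): then `κ₃(f,f,f) = p − 3p² + 2p³ =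
p(1−p)(1−2p)`, negative for `1/2 < p < 1`, whereas `κ′₃(f,f,f) = E₃(f,f,f) = 2p − 3p² + p³ = p(1−p)(2−p) ≥ 0`.
Concretely, on the two-point chain `false < true` with the (FKG) weight `μ(true) = 2/3` and `f = 1_{true}`
(nonnegative, increasing): `κ₃ = −2/27 < 0 = ` while `E₃ = 8/27`.  So the cumulant is not a candidate for `C₃`
even on a chain, where `E_n ≥ 0` holds for every `n` (`sahiPositive_of_linearOrder`, `TotalOrder.lean`). -/

/-- **`κ₃` of a repeated idempotent.** If `f * f = f` (e.g. `f` is the indicator of an event) and `p = E f`, then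
`κ₃(f,f,f) = p(1 − p)(1 − 2p)` (`= p − 3p² + 2p³`, from (1.5)).
[cite: Richards2004, eq. (1.5) (p. 1512); LiebSahi2021, p. 3 ("already fails for κ₃")] -/
theorem cumulant_three_idem (μ : α → ℝ) {f : α → ℝ} (hf : f * f = f) :
    cumulant μ 3 ![f, f, f] = ex μ f * (1 - ex μ f) * (1 - 2 * ex μ f) := by
  rw [cumulant_three, hf, hf]
  ring

/-- **`κ′₃ = E₃` of a repeated idempotent.** If `f * f = f` and `p = E f`, then `κ′₃(f,f,f) = p(1 − p)(2 − p)`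
(`= 2p − 3p² + p³`, from (1.6)). [cite: Richards2004, eq. (1.6) (p. 1512); LiebSahi2021, p. 3] -/
theorem conjCumulant_three_idem (μ : α → ℝ) {f : α → ℝ} (hf : f * f = f) :
    conjCumulant μ 3 ![f, f, f] = ex μ f * (1 - ex μ f) * (2 - ex μ f) := by
  rw [conjCumulant_three, hf, hf]
  ring

/-- For a repeated idempotent of mass `p ∈ [0,1]`, `κ′₃ = E₃ = p(1−p)(2−p) ≥ 0` (no conjecture needed).
[cite: Richards2004, eq. (1.6) (p. 1512); LiebSahi2021, p. 3] -/
theorem conjCumulant_three_idem_nonneg (μ : α → ℝ) {f : α → ℝ} (hf : f * f = f) (h0 : 0 ≤ ex μ f)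
    (h1 : ex μ f ≤ 1) : 0 ≤ conjCumulant μ 3 ![f, f, f] := by
  rw [conjCumulant_three_idem μ hf]
  exact mul_nonneg (mul_nonneg h0 (by linarith)) (by linarith)

/-- **The cumulant inequality fails at order 3**: for a repeated idempotent of mass `1/2 < p < 1`,
`κ₃(f,f,f) = p(1−p)(1−2p) < 0`. [cite: LiebSahi2021, p. 3 ("an easy example shows that the inequality already
fails for κ₃"); Richards2004, eq. (1.5) (p. 1512)] -/
theorem cumulant_three_idem_neg (μ : α → ℝ) {f : α → ℝ} (hf : f * f = f) (h : 1 / 2 < ex μ f)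
    (h1 : ex μ f < 1) : cumulant μ 3 ![f, f, f] < 0 := by
  rw [cumulant_three_idem μ hf]
  exact mul_neg_of_pos_of_neg (mul_pos (by linarith) (by linarith)) (by linarith)

/-! #### The concrete two-point example -/

/-- The weight `μ(false) = 1/3`, `μ(true) = 2/3` on the two-point chain `Bool`. [folklore] -/
def twoThirdsWeight : Bool → ℝ := fun b => if b then 2 / 3 else 1 / 3

/-- The indicator of `true` (an increasing event of the chain `false < true`). [folklore] -/
def indTrue : Bool → ℝ := fun b => if b then 1 else 0

/-- `twoThirdsWeight` is an FKG probability weight (every probability weight on a chain is).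
[cite: FortuinKasteleynGinibre1971, p. 89–90 (totally ordered case); LiebSahi2021, p. 3] -/
theorem isFKGMeasure_twoThirdsWeight : IsFKGMeasure twoThirdsWeight where
  nonneg b := by cases b <;> norm_num [twoThirdsWeight]
  sum_eq_one := by norm_num [twoThirdsWeight, Fintype.sum_bool]
  mul_le_mul a b := by cases a <;> cases b <;> norm_num [twoThirdsWeight]

/-- `indTrue` is increasing (helper; the public statement is `liebSahi_cumulant_three_fails`). [folklore] -/
private theorem indTrue_monotone : Monotone indTrue := by
  intro a b hab
  cases a <;> cases b <;> norm_num [indTrue] at hab ⊢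
  exact absurd hab (by decide)

/-- **Lieb–Sahi's "easy example", made explicit.** On the two-point chain with the FKG probability weight
`μ(true) = 2/3` and the nonnegative increasing function `f = 1_{true}`: Richards' cumulant
`κ₃(f,f,f) = −2/27 < 0`, while Sahi's `E₃(f,f,f) = κ′₃(f,f,f) = 8/27 > 0`.  Hence "`κ₃ ≥ 0` for nonnegative
increasing functions under an FKG weight" is FALSE already on a chain (where `C_n` holds for all `n`).
[cite: LiebSahi2021, p. 3 ("an easy example shows that the inequality already fails for κ₃");
Richards2004, eqs. (1.5)–(1.6) (p. 1512)] -/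
theorem liebSahi_cumulant_three_fails :
    IsFKGMeasure twoThirdsWeight ∧ Monotone indTrue ∧ (∀ b, 0 ≤ indTrue b) ∧
      cumulant twoThirdsWeight 3 ![indTrue, indTrue, indTrue] = -(2 / 27) ∧
      sahiE twoThirdsWeight 3 ![indTrue, indTrue, indTrue] = 8 / 27 ∧
      conjCumulant twoThirdsWeight 3 ![indTrue, indTrue, indTrue] = 8 / 27 := by
  have hf : indTrue * indTrue = indTrue := by
    funext b; cases b <;> norm_num [indTrue]
  have hex : ex twoThirdsWeight indTrue = 2 / 3 := by
    norm_num [ex, Fintype.sum_bool, twoThirdsWeight, indTrue]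
  refine ⟨isFKGMeasure_twoThirdsWeight, indTrue_monotone, fun b => by cases b <;> norm_num [indTrue], ?_, ?_, ?_⟩
  · rw [cumulant_three_idem _ hf, hex]; norm_num
  · rw [← conjCumulant_eq_sahiE (by norm_num) (by norm_num), conjCumulant_three_idem _ hf, hex]; norm_num
  · rw [conjCumulant_three_idem _ hf, hex]; norm_num

/-- Existential form: there are a finite distributive lattice (indeed a two-point chain), an FKG probability
weight and a nonnegative increasing `f` with `κ₃(f,f,f) < 0 < E₃(f,f,f)`.
[cite: LiebSahi2021, p. 3; Richards2004, eqs. (1.5)–(1.6) (p. 1512)] -/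
theorem exists_cumulant_three_neg :
    ∃ (μ : Bool → ℝ) (f : Bool → ℝ), IsFKGMeasure μ ∧ Monotone f ∧ (∀ b, 0 ≤ f b) ∧
      cumulant μ 3 ![f, f, f] < 0 ∧ 0 < sahiE μ 3 ![f, f, f] := by
  obtain ⟨h1, h2, h3, h4, h5, -⟩ := liebSahi_cumulant_three_fails
  exact ⟨_, _, h1, h2, h3, by rw [h4]; norm_num, by rw [h5]; norm_num⟩

end Richards2004

end

end Literature.Combinatorics.Sahi2008
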